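import Mathlib
import Literature.AlgebraicGeometry.Resolution.LocalBlowup
import Literature.AlgebraicGeometry.Resolution.TranscendenceDefect
import Literature.AlgebraicGeometry.Resolution.ResolutionOfSingularities
import Literature.FieldTheory.Separability.PDegreeSeparablyGenerated
import Literature.AlgebraicGeometry.Resolution.QuadraticTransformsRegular
import HarnessLib

/-!
# Crux `DescentPerfectToAll` (stmt-ResolutionOfSingularities-0549) — lens 5 «transfer from the solved sibling», g9:
# THEOREM T typed — the slice {`k` perfect, `[Γ : pΓ] = p²`} of `stub_cleanLU3DefectNonDiscrete`, and the kernel-checked cut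

CENSUS workfile (res-B-lens-5 g9, 2026-08-29).  OURS · CANDIDATE · counted 0.  Nothing here proves resolution in characteristic `p`;
no crux, stub or named fact is proved here.  Companion memo: `Cruxes/DescentPerfectToAll/CLASSBC-prank2-toric-lens5-g9.md` (THEOREM T,
hand proof, AI-written, NOT kernel-checked).  Customer: the line lead of crux stmt-15917 `RadicialJung.CleanModels`, skeleton
`Cruxes/CleanModels/Lines/Sketch.lean` rev 24, registered research stub `stub_cleanLU3DefectNonDiscrete` (:218; classes (B) rank one
non-discrete and (C) composite of the class map `Sketch-memo-nondiscrete-classC.md`), reached from this crux through the slot line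
`Lines/via_clean_models.lean` (0549 ⟸ `CossartPiltant2019` ∧ CleanModels|_{dim ≥ 4}).

WHAT IS HERE (self-contained: `Mathlib` + two `Literature` files; the `Cruxes/…` modules are not built on the farm, so the currency
`CleanLUConcl` / `CleanLU3DefectNonDiscreteAt` of `Census_lens5_cpBaseSide.lean` §3/§3c is restated verbatim):
* `PRankTwoAt p O` — hypothesis (P2) of THEOREM T: `x, y ∈ K^×` whose values are `𝔽_p`-independent modulo `p`-th-power values,
  i.e. `[Γ : pΓ] = p²` (the maximum allowed by `rr Γ ≤ 2`);
* `CleanLU3DefectPRankTwoAt p` — the stub's statement at `p` on the slice {`PerfectField k`, `PRankTwoAt p O`}: THEOREM T says it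
  HOLDS for every `p`, modulo `CossartPiltant2019` (applied to a 3-fold model of the Frobenius twist `M = K^p(g₀) ≅ K(g₀^{1/p})`) and
  embedded resolution of surfaces (CJS 2020) — by hand (memo §1–§5), in loosely clean FORM (3) with `c' = 0`;
* `CleanLU3DefectPRankLEOneAt p` (perfect `k`, `¬ PRankTwoAt`: `[Γ:pΓ] ≤ p`, where `K/M` itself has defect) and
  `CleanLU3DefectImperfectAt p` (imperfect `k`) — the honest RESIDUALS, untouched;
* `cleanLU3DefectNonDiscreteAt_iff_slices` ✓ — the stub at `p` is EQUIVALENT to the conjunction of the three slices (kernel-checked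
  bookkeeping: `by_cases` on `PerfectField k` and on `PRankTwoAt p O`);
* `exponents_eq_zero_of_valuation_eq_one` ✓ — the punchline lemma (PB0) of the memo: under (P2), a product `ν · x^a y^b`
  (`a, b < p`) of VALUE ZERO whose coefficient `ν` has a `p`-th-power value has `a = b = 0`.
* rev 2 (THEOREM T′, memo §10): `SepGenerated k K`, `ResidueSeparable k O` and the slice `CleanLU3DefectPRankTwoSepAt p` — (P2) +
  `K/k` separably generated + residue field separable over `k`, NO perfectness —, claimed by the hand proof of §10 (same mechanism with
  `M⁺ = k·K^p(g₀)`, `T⁺ = T'' ⊗_{k^p} k`, point equations over `k^p`); the imperfect residual split accordingly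
  (`CleanLU3DefectImperfectInsepAt`, `CleanLU3DefectImperfectPRankLEOneAt`) and the FIVE-slice cut `cleanLU3DefectNonDiscreteAt_of_five` ✓.
* rev 3: `residueSeparable_of_isMaximal_centre` ✓ — (SEP-κ) follows from the stub's own zero-dimensionality hypothesis over a perfect field
  (Zariski's lemma + perfectness); the bridge `cleanLU3DefectPRankTwoAt_of_sep` ✓ now takes only MacLane's separating-transcendence-basis
  fact (`SepGeneratedOfPerfect`, unproved) as hypothesis.  THEOREM T/T′ were paper-verified by the critic (bus TRIAGE-64, 2026-08-29).
* rev 8: `PDegreeThreeOfSepGenerated` (§7, the T′ input) is PROVED in the sibling workfile `Lens5_PDegreeSep.lean` (statement verbatim);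
  it stays a `def` here only because crux workfiles cannot import each other.
* rev 6 (after INPUTS ★ PRICE WORD l.85587 / R258): `PDegreeThreeOfPerfect` is DOMINATED BY THE TREE — PROVED here as
  `pDegreeThreeOfPerfect` from `Literature.FieldTheory.Separability.finrank_frobenius_eq_pow_of_trdeg_eq` (Matsumura Thm 26.5, in tree,
  sorry-free) + `Literature.RingTheory.KrullDimension.exists_ringKrullDim_eq_and_trdeg_eq` (Thm 5.6); `SepGeneratedOfPerfect` PROVED as
  `sepGeneratedOfPerfect` from Mathlib's `exists_isTranscendenceBasis_and_isSeparable_of_perfectField`; hence the bridge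
  `cleanLU3DefectPRankTwoAt_of_sep` is now HYPOTHESIS-FREE (T′-slice ⟹ T-slice outright).  `PDegreeThreeOfSepGenerated` (relative base
  `k·K^p`, imperfect `k`) stays a statement: PRINT (Matsumura Thm 26.5) but «textbook, prove it», size M, NOT keyed, not needed over perfect `k`.
* rev 7 (§8): EXIT LEMMA `cleanLUConcl_of_parameter` — a regular parameter `ψ ∈ 𝔪 ∖ 𝔪²` of a regular `locAtCentre A''.toSubring O`
  (`A ≤ A'' ≤ O`, `A''.FG`) written `ψ = Σ_{j<p} c_j^p g₀^j` gives `CleanLUConcl p k K O A g₀` in FORM (3) with `c′ = 0`, the representative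
  being non-trivial automatically (regular ⇒ normal ⇒ `ψ` is no `p`-th power in `K`; tree `isIntegrallyClosedIn_of_isRegularLocalRing`).
  This is the last line of THEOREM T (memo §5) against the customer's verbatim conclusion.
* rev 5 (§7): the one field-theoretic input of (PB) typed as named facts `PDegreeThreeOfPerfect` / `PDegreeThreeOfSepGenerated`
  (p-degree `[K : kK^p] = p³`; unproved here); the valuation half of (PB) and `[K : K^p(g₀)] = p²`-from-p-degree are kernel-checked in
  `Lens5_GradedBasis.lean` / `Lens5_ImmediateValues.lean`.
* rev 4 (§6): the perfect-field residual `[Γ:pΓ] ≤ p` split into `s = 1` (`PRankOneAt`, slice `CleanLU3DefectPRankOneAt`) and `s = 0`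
  (`PDivisibleValuesAt`, slice `CleanLU3DefectPDivAt`), `cleanLU3DefectPRankLEOneAt_of_split` ✓ — sized in memo §11; nothing claimed.
Resolution of singularities in positive characteristic is NOT proved; rung B of the ladder lives in `dim ≥ 4`.
-/

noncomputable section

set_option linter.dupNamespace false

open IsLocalRing
open Literature.AlgebraicGeometry.Resolution

namespace Summit.ResolutionOfSingularities.ResolutionOfSingularities.Cruxes.DescentPerfectToAll.CpSibling.PRankTwo

/-! ## §1 Currency (verbatim from `Census_lens5_cpBaseSide.lean` §3 / §3c) -/

/-- The common conclusion of `stub_cleanLU3*`: a finitely generated `A ≤ A' ⊆ O`, regular at the centre of `O`, carrying a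
non-trivial representative `Σ c_j^p g₀^j` of the `K^p`-line of `g₀` in loose clean form (1) ∨ (2) ∨ (3). [folklore] -/
def CleanLUConcl (p : ℕ) (k K : Type) [Field k] [Field K] [Algebra k K] (O : ValuationSubring K) (A : Subalgebra k K)
    (g₀ : K) : Prop :=
    ∃ (A' : Subalgebra k K), A'.toSubring ≤ O.toSubring ∧ A ≤ A' ∧ A'.FG ∧
      ∃ (_ : IsRegularLocalRing (locAtCentre A'.toSubring O)) (c : Fin p → K),
        (∃ j : Fin p, (j : ℕ) ≠ 0 ∧ c j ≠ 0) ∧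
        ((∃ (d m : ℕ) (hmd : m ≤ d) (t : Fin d → ↥(locAtCentre A'.toSubring O)) (a : Fin m → ℕ)
            (u : ↥(locAtCentre A'.toSubring O)), IsUnit u ∧
            Ideal.span (Set.range t) = IsLocalRing.maximalIdeal ↥(locAtCentre A'.toSubring O) ∧
            ringKrullDim ↥(locAtCentre A'.toSubring O) = (d : WithBot ℕ∞) ∧ 0 < m ∧ (∀ i, ¬ p ∣ a i) ∧
            (∑ j : Fin p, c j ^ p * g₀ ^ (j : ℕ)) =
              (u : K) * ∏ i : Fin m, ((t (Fin.castLE hmd i) : ↥(locAtCentre A'.toSubring O)) : K) ^ (a i)) ∨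
          (∃ u : ↥(locAtCentre A'.toSubring O), IsUnit u ∧ (∑ j : Fin p, c j ^ p * g₀ ^ (j : ℕ)) = (u : K) ∧
            ∀ c' : ↥(locAtCentre A'.toSubring O), u - c' ^ p ∉ IsLocalRing.maximalIdeal ↥(locAtCentre A'.toSubring O)) ∨
          (∃ s c' : ↥(locAtCentre A'.toSubring O), (∑ j : Fin p, c j ^ p * g₀ ^ (j : ℕ)) = (s : K) ∧
            s - c' ^ p ∈ IsLocalRing.maximalIdeal ↥(locAtCentre A'.toSubring O) ∧
            s - c' ^ p ∉ IsLocalRing.maximalIdeal ↥(locAtCentre A'.toSubring O) ^ 2))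

/-- **`stub_cleanLU3DefectNonDiscrete` (Sketch rev 24 :218) at the prime `p`** — hypotheses verbatim (zero-dimensional `O`,
immediate `K^p`-line of `g₀`, positive transcendence defect, not discrete of rank one), conclusion folded into `CleanLUConcl`.
RESEARCH (classes (B)/(C)). [folklore] -/
def CleanLU3DefectNonDiscreteAt (p : ℕ) : Prop :=
    ∀ (k : Type) [Field k] [CharP k p] (K : Type) [Field K] [Algebra k K]
    (O : ValuationSubring K) (A : Subalgebra k K), A.toSubring ≤ O.toSubring → A.FG → IsFractionRing A K →
    ringKrullDim A ≤ 3 → IsRegularLocalRing (locAtCentre A.toSubring O) →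
    ringKrullDim (locAtCentre A.toSubring O) = 3 →
    (∀ (T : Subring K) (hT : T ≤ O.toSubring), A.toSubring ≤ T → (subringCentre T O hT).IsMaximal) →
    ∀ g₀ : K, (∀ c : K, c ^ p ≠ g₀) →
    (∀ f₀ : K, ∃ f₁ : K, O.valuation (g₀ - f₁ ^ p) < O.valuation (g₀ - f₀ ^ p)) →
    (∀ hk : ∀ c : k, algebraMap k K c ∈ O, transcendenceDefect k O hk ≠ 0) →
    ¬ (∃ π : K, π ≠ 0 ∧ (∀ x : K, O.valuation x < 1 → O.valuation x ≤ O.valuation π) ∧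
      (∀ x : K, x ≠ 0 → ∃ n : ℕ, O.valuation π ^ n ≤ O.valuation x)) →
    CleanLUConcl p k K O A g₀

/-! ## §2 Hypothesis (P2) and the three slices -/

/-- **(P2) `[Γ : pΓ] = p²`**: there are `x, y ∈ K^×` such that no non-trivial monomial `x^a y^b` (`0 ≤ a, b < p`, not both `0`) has
the value of a `p`-th power.  Equivalently the `𝔽_p`-space `Γ/pΓ` has dimension `2` (`≤ rr Γ ≤ 2` always under positive
transcendence defect).  Holds for every finitely generated `Γ ≅ ℤ²` (rank one `ℤ + ℤτ`, or `ℤ ×_lex ℤ`); fails for `Γ ⊆ ℚ` and for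
groups with a `p`-divisible direction. [folklore] -/
def PRankTwoAt {K : Type} [Field K] (p : ℕ) (O : ValuationSubring K) : Prop :=
    ∃ x y : K, x ≠ 0 ∧ y ≠ 0 ∧ ∀ a b : ℕ, a < p → b < p → (a ≠ 0 ∨ b ≠ 0) →
      ∀ z : K, z ≠ 0 → O.valuation (x ^ a * y ^ b) ≠ O.valuation (z ^ p)

/-- **THEOREM T's slice** — `stub_cleanLU3DefectNonDiscrete` at `p` restricted to PERFECT ground fields and valuations with
`[Γ : pΓ] = p²`.  CLAIMED TRUE for every prime `p` by the hand proof of `CLASSBC-prank2-toric-lens5-g9.md` §1–§5 (valuation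
`p`-basis `{x^a y^b}` of `K` over `M = K^p(g₀)`, Cossart–Piltant 2019 for a 3-fold model of `M`, CJS monomialisation of `x^p, y^p`,
toric chart on the refined exponent lattice, «value-zero monomial lies in `M`» ⇒ a regular parameter in `M ∖ K^p` = form (3),
`c' = 0`), modulo the named facts `CossartPiltant2019` and CJS 2020; NOT kernel-checked.  OURS · CANDIDATE · counted 0. [folklore] -/
def CleanLU3DefectPRankTwoAt (p : ℕ) : Prop :=
    ∀ (k : Type) [Field k] [CharP k p] [PerfectField k] (K : Type) [Field K] [Algebra k K]
    (O : ValuationSubring K) (A : Subalgebra k K), A.toSubring ≤ O.toSubring → A.FG → IsFractionRing A K →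
    ringKrullDim A ≤ 3 → IsRegularLocalRing (locAtCentre A.toSubring O) →
    ringKrullDim (locAtCentre A.toSubring O) = 3 →
    (∀ (T : Subring K) (hT : T ≤ O.toSubring), A.toSubring ≤ T → (subringCentre T O hT).IsMaximal) →
    ∀ g₀ : K, (∀ c : K, c ^ p ≠ g₀) →
    (∀ f₀ : K, ∃ f₁ : K, O.valuation (g₀ - f₁ ^ p) < O.valuation (g₀ - f₀ ^ p)) →
    (∀ hk : ∀ c : k, algebraMap k K c ∈ O, transcendenceDefect k O hk ≠ 0) →
    ¬ (∃ π : K, π ≠ 0 ∧ (∀ x : K, O.valuation x < 1 → O.valuation x ≤ O.valuation π) ∧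
      (∀ x : K, x ≠ 0 → ∃ n : ℕ, O.valuation π ^ n ≤ O.valuation x)) →
    PRankTwoAt p O →
    CleanLUConcl p k K O A g₀

/-- **Residual 1** — perfect ground field, `[Γ : pΓ] ≤ p` (`¬ PRankTwoAt`): all of class (B-rr1) (`Γ ⊆ ℚ` non-discrete) and the
rational-rank-2 groups with a `p`-divisible direction; here `K/K^p(g₀)` ITSELF has defect and THEOREM T's valuation basis does not
exist.  RESEARCH; nothing claimed. [folklore] -/
def CleanLU3DefectPRankLEOneAt (p : ℕ) : Prop :=
    ∀ (k : Type) [Field k] [CharP k p] [PerfectField k] (K : Type) [Field K] [Algebra k K]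
    (O : ValuationSubring K) (A : Subalgebra k K), A.toSubring ≤ O.toSubring → A.FG → IsFractionRing A K →
    ringKrullDim A ≤ 3 → IsRegularLocalRing (locAtCentre A.toSubring O) →
    ringKrullDim (locAtCentre A.toSubring O) = 3 →
    (∀ (T : Subring K) (hT : T ≤ O.toSubring), A.toSubring ≤ T → (subringCentre T O hT).IsMaximal) →
    ∀ g₀ : K, (∀ c : K, c ^ p ≠ g₀) →
    (∀ f₀ : K, ∃ f₁ : K, O.valuation (g₀ - f₁ ^ p) < O.valuation (g₀ - f₀ ^ p)) →
    (∀ hk : ∀ c : k, algebraMap k K c ∈ O, transcendenceDefect k O hk ≠ 0) →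
    ¬ (∃ π : K, π ≠ 0 ∧ (∀ x : K, O.valuation x < 1 → O.valuation x ≤ O.valuation π) ∧
      (∀ x : K, x ≠ 0 → ∃ n : ℕ, O.valuation π ^ n ≤ O.valuation x)) →
    ¬ PRankTwoAt p O →
    CleanLUConcl p k K O A g₀

/-- **Residual 2** — IMPERFECT ground field (any value group): the valuation basis acquires constant directions and the value-zero
monomials land in `k·K^p(g₀)`, not in `K^p(g₀)`; the natural exit would be form (2).  RESEARCH; nothing claimed. [folklore] -/
def CleanLU3DefectImperfectAt (p : ℕ) : Prop :=
    ∀ (k : Type) [Field k] [CharP k p], ¬ PerfectField k → ∀ (K : Type) [Field K] [Algebra k K]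
    (O : ValuationSubring K) (A : Subalgebra k K), A.toSubring ≤ O.toSubring → A.FG → IsFractionRing A K →
    ringKrullDim A ≤ 3 → IsRegularLocalRing (locAtCentre A.toSubring O) →
    ringKrullDim (locAtCentre A.toSubring O) = 3 →
    (∀ (T : Subring K) (hT : T ≤ O.toSubring), A.toSubring ≤ T → (subringCentre T O hT).IsMaximal) →
    ∀ g₀ : K, (∀ c : K, c ^ p ≠ g₀) →
    (∀ f₀ : K, ∃ f₁ : K, O.valuation (g₀ - f₁ ^ p) < O.valuation (g₀ - f₀ ^ p)) →
    (∀ hk : ∀ c : k, algebraMap k K c ∈ O, transcendenceDefect k O hk ≠ 0) →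
    ¬ (∃ π : K, π ≠ 0 ∧ (∀ x : K, O.valuation x < 1 → O.valuation x ≤ O.valuation π) ∧
      (∀ x : K, x ≠ 0 → ∃ n : ℕ, O.valuation π ^ n ≤ O.valuation x)) →
    CleanLUConcl p k K O A g₀

/-! ## §3 The cut (kernel-checked bookkeeping) -/

/-- The stub at `p` ⟸ the three slices. [folklore] -/
theorem cleanLU3DefectNonDiscreteAt_of_slices (p : ℕ) (h2 : CleanLU3DefectPRankTwoAt p)
    (h1 : CleanLU3DefectPRankLEOneAt p) (hi : CleanLU3DefectImperfectAt p) : CleanLU3DefectNonDiscreteAt p := by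
  intro k _ _ K _ _ O A hAO hAfg hfrac hdimA hreg hdim3 hzd g₀ hg₀ hdef htd hnd
  by_cases hk : PerfectField k
  · by_cases hP : PRankTwoAt p O
    · exact h2 k K O A hAO hAfg hfrac hdimA hreg hdim3 hzd g₀ hg₀ hdef htd hnd hP
    · exact h1 k K O A hAO hAfg hfrac hdimA hreg hdim3 hzd g₀ hg₀ hdef htd hnd hP
  · exact hi k hk K O A hAO hAfg hfrac hdimA hreg hdim3 hzd g₀ hg₀ hdef htd hnd

/-- The three slices ⟸ the stub at `p` (they are special cases). [folklore] -/
theorem slices_of_cleanLU3DefectNonDiscreteAt (p : ℕ) (h : CleanLU3DefectNonDiscreteAt p) :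
    CleanLU3DefectPRankTwoAt p ∧ CleanLU3DefectPRankLEOneAt p ∧ CleanLU3DefectImperfectAt p := by
  refine ⟨?_, ?_, ?_⟩
  · intro k _ _ _ K _ _ O A hAO hAfg hfrac hdimA hreg hdim3 hzd g₀ hg₀ hdef htd hnd _
    exact h k K O A hAO hAfg hfrac hdimA hreg hdim3 hzd g₀ hg₀ hdef htd hnd
  · intro k _ _ _ K _ _ O A hAO hAfg hfrac hdimA hreg hdim3 hzd g₀ hg₀ hdef htd hnd _
    exact h k K O A hAO hAfg hfrac hdimA hreg hdim3 hzd g₀ hg₀ hdef htd hnd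
  · intro k _ _ _ K _ _ O A hAO hAfg hfrac hdimA hreg hdim3 hzd g₀ hg₀ hdef htd hnd
    exact h k K O A hAO hAfg hfrac hdimA hreg hdim3 hzd g₀ hg₀ hdef htd hnd

/-- `stub_cleanLU3DefectNonDiscrete` at `p` ⟺ (THEOREM T's slice) ∧ (residual `[Γ:pΓ] ≤ p`) ∧ (residual imperfect `k`). [folklore] -/
theorem cleanLU3DefectNonDiscreteAt_iff_slices (p : ℕ) : CleanLU3DefectNonDiscreteAt p ↔
    CleanLU3DefectPRankTwoAt p ∧ CleanLU3DefectPRankLEOneAt p ∧ CleanLU3DefectImperfectAt p :=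
  ⟨slices_of_cleanLU3DefectNonDiscreteAt p, fun h => cleanLU3DefectNonDiscreteAt_of_slices p h.1 h.2.1 h.2.2⟩

/-! ## §4 The punchline lemma (PB0) of the memo, kernel-checked -/

/-- **(PB0)** Under (P2) for `x, y`: if `ν · (x^a y^b)` (`a, b < p`) has value zero (`valuation = 1`) and `ν` has the value of a
`p`-th power `z^p` (`z ≠ 0`), then `a = b = 0`.  In THEOREM T this forces every value-zero Laurent monomial of the toric chart into
`M = K^p(g₀)`, whence a regular parameter in `M ∖ K^p`, i.e. loosely clean form (3). [folklore] -/
theorem exponents_eq_zero_of_valuation_eq_one {K : Type} [Field K] {p : ℕ} (O : ValuationSubring K) {x y : K}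
    (hP : ∀ a b : ℕ, a < p → b < p → (a ≠ 0 ∨ b ≠ 0) → ∀ z : K, z ≠ 0 → O.valuation (x ^ a * y ^ b) ≠ O.valuation (z ^ p))
    {a b : ℕ} (ha : a < p) (hb : b < p) {ν z : K} (hz : z ≠ 0) (hν : O.valuation ν = O.valuation (z ^ p))
    (hval : O.valuation (ν * (x ^ a * y ^ b)) = 1) : a = 0 ∧ b = 0 := by
  by_contra hab
  have hab' : a ≠ 0 ∨ b ≠ 0 := by
    by_cases h : a = 0
    · exact Or.inr fun hb0 => hab ⟨h, hb0⟩
    · exact Or.inl h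
  rw [map_mul] at hval
  have hmono : O.valuation (x ^ a * y ^ b) = (O.valuation ν)⁻¹ := eq_inv_of_mul_eq_one_right hval
  have hzinv : z⁻¹ ≠ 0 := inv_ne_zero hz
  apply hP a b ha hb hab' z⁻¹ hzinv
  rw [hmono, hν, inv_pow, map_inv₀]

/-- (P2) is symmetric under inverting `x` (used in the memo to arrange `v(x), v(y) > 0`). [folklore] -/
theorem pRankTwo_inv_left {K : Type} [Field K] {p : ℕ} (O : ValuationSubring K) {x y : K} (hx : x ≠ 0)
    (hP : ∀ a b : ℕ, a < p → b < p → (a ≠ 0 ∨ b ≠ 0) → ∀ z : K, z ≠ 0 → O.valuation (x ^ a * y ^ b) ≠ O.valuation (z ^ p)) :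
    ∀ a b : ℕ, a < p → b < p → (a ≠ 0 ∨ b ≠ 0) → ∀ z : K, z ≠ 0 →
      O.valuation (x⁻¹ ^ a * y ^ b) ≠ O.valuation (z ^ p) := by
  intro a b ha hb hab z hz h
  -- `x⁻¹^a y^b = x^{-a} y^b`; multiply by `x^{a} · x^{(p-1)a}`-type bookkeeping: compare `x^{p-a} y^b` if `a ≠ 0`, else `b ≠ 0` directly
  rcases Nat.eq_zero_or_pos a with rfl | hapos
  · simp only [pow_zero, one_mul] at h
    exact hP 0 b ha hb hab z hz (by simpa using h)
  · -- `a > 0`: `x^{p-a} y^b = x^p · (x⁻¹^a y^b)` has the value of `(x z)^p`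
    have hpa : p - a < p := Nat.sub_lt (lt_of_le_of_lt (Nat.zero_le a) ha) hapos
    have hpa0 : p - a ≠ 0 := Nat.sub_ne_zero_of_lt ha
    apply hP (p - a) b hpa hb (Or.inl hpa0) (x * z) (mul_ne_zero hx hz)
    have hxp : x ^ (p - a) = x ^ p * x⁻¹ ^ a := by
      rw [inv_pow, ← div_eq_mul_inv, eq_div_iff (pow_ne_zero a hx), ← pow_add, Nat.sub_add_cancel (le_of_lt ha)]
    rw [hxp, mul_assoc, map_mul, h, ← map_mul, ← mul_pow]

/-! ## §5 (rev 2) THEOREM T′ — imperfect ground fields with separable `K/k` and `κ_v/k` -/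

/-- (SEP-K) `K/k` is separably generated: some finite algebraically independent family `s` over which `K` is separable algebraic
(a separating transcendence basis).  Automatic when `k` is perfect (folklore; not proved here). [folklore] -/
def SepGenerated (k K : Type) [Field k] [Field K] [Algebra k K] : Prop :=
    ∃ (n : ℕ) (s : Fin n → K), AlgebraicIndependent k s ∧
      Algebra.IsSeparable (IntermediateField.adjoin k (Set.range s)) K

/-- (SEP-κ) the residue field of `O` is separable over `k`: every residue is a root of a separable polynomial with coefficients in `k`
(stated inside `K`: `v(P(t)) < 1`).  Automatic when `k` is perfect and `O` is zero-dimensional (folklore; not proved here). [folklore] -/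
def ResidueSeparable (k : Type) {K : Type} [Field k] [Field K] [Algebra k K] (O : ValuationSubring K) : Prop :=
    ∀ t : K, t ∈ O → ∃ P : Polynomial k, P.Separable ∧ O.valuation (Polynomial.aeval t P) < 1

/-- **THEOREM T′'s slice** — `stub_cleanLU3DefectNonDiscrete` at `p` on {(P2), `K/k` separably generated, residue field separable over
`k`}, ANY ground field `k` of characteristic `p`.  CLAIMED TRUE for every `p` by the hand proof of `CLASSBC-prank2-toric-lens5-g9.md` §10
(modulo `CossartPiltant2019` over the field `k^p` and CJS); NOT kernel-checked.  Contains THEOREM T's slice (perfect `k`) modulo the two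
folklore facts named in `SepGenerated` / `ResidueSeparable`.  OURS · CANDIDATE · counted 0. [folklore] -/
def CleanLU3DefectPRankTwoSepAt (p : ℕ) : Prop :=
    ∀ (k : Type) [Field k] [CharP k p] (K : Type) [Field K] [Algebra k K]
    (O : ValuationSubring K) (A : Subalgebra k K), A.toSubring ≤ O.toSubring → A.FG → IsFractionRing A K →
    ringKrullDim A ≤ 3 → IsRegularLocalRing (locAtCentre A.toSubring O) →
    ringKrullDim (locAtCentre A.toSubring O) = 3 →
    (∀ (T : Subring K) (hT : T ≤ O.toSubring), A.toSubring ≤ T → (subringCentre T O hT).IsMaximal) →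
    ∀ g₀ : K, (∀ c : K, c ^ p ≠ g₀) →
    (∀ f₀ : K, ∃ f₁ : K, O.valuation (g₀ - f₁ ^ p) < O.valuation (g₀ - f₀ ^ p)) →
    (∀ hk : ∀ c : k, algebraMap k K c ∈ O, transcendenceDefect k O hk ≠ 0) →
    ¬ (∃ π : K, π ≠ 0 ∧ (∀ x : K, O.valuation x < 1 → O.valuation x ≤ O.valuation π) ∧
      (∀ x : K, x ≠ 0 → ∃ n : ℕ, O.valuation π ^ n ≤ O.valuation x)) →
    PRankTwoAt p O → SepGenerated k K → ResidueSeparable k O →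
    CleanLUConcl p k K O A g₀

/-- **Residual 2a** — imperfect `k`, (P2), but `K/k` NOT separably generated or the residue field inseparable over `k` (constants ramify or
are immediate).  RESEARCH; nothing claimed. [folklore] -/
def CleanLU3DefectImperfectInsepAt (p : ℕ) : Prop :=
    ∀ (k : Type) [Field k] [CharP k p], ¬ PerfectField k → ∀ (K : Type) [Field K] [Algebra k K]
    (O : ValuationSubring K) (A : Subalgebra k K), A.toSubring ≤ O.toSubring → A.FG → IsFractionRing A K →
    ringKrullDim A ≤ 3 → IsRegularLocalRing (locAtCentre A.toSubring O) →
    ringKrullDim (locAtCentre A.toSubring O) = 3 →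
    (∀ (T : Subring K) (hT : T ≤ O.toSubring), A.toSubring ≤ T → (subringCentre T O hT).IsMaximal) →
    ∀ g₀ : K, (∀ c : K, c ^ p ≠ g₀) →
    (∀ f₀ : K, ∃ f₁ : K, O.valuation (g₀ - f₁ ^ p) < O.valuation (g₀ - f₀ ^ p)) →
    (∀ hk : ∀ c : k, algebraMap k K c ∈ O, transcendenceDefect k O hk ≠ 0) →
    ¬ (∃ π : K, π ≠ 0 ∧ (∀ x : K, O.valuation x < 1 → O.valuation x ≤ O.valuation π) ∧
      (∀ x : K, x ≠ 0 → ∃ n : ℕ, O.valuation π ^ n ≤ O.valuation x)) →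
    PRankTwoAt p O → ¬ (SepGenerated k K ∧ ResidueSeparable k O) →
    CleanLUConcl p k K O A g₀

/-- **Residual 2b** — imperfect `k`, `[Γ:pΓ] ≤ p`.  RESEARCH; nothing claimed. [folklore] -/
def CleanLU3DefectImperfectPRankLEOneAt (p : ℕ) : Prop :=
    ∀ (k : Type) [Field k] [CharP k p], ¬ PerfectField k → ∀ (K : Type) [Field K] [Algebra k K]
    (O : ValuationSubring K) (A : Subalgebra k K), A.toSubring ≤ O.toSubring → A.FG → IsFractionRing A K →
    ringKrullDim A ≤ 3 → IsRegularLocalRing (locAtCentre A.toSubring O) →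
    ringKrullDim (locAtCentre A.toSubring O) = 3 →
    (∀ (T : Subring K) (hT : T ≤ O.toSubring), A.toSubring ≤ T → (subringCentre T O hT).IsMaximal) →
    ∀ g₀ : K, (∀ c : K, c ^ p ≠ g₀) →
    (∀ f₀ : K, ∃ f₁ : K, O.valuation (g₀ - f₁ ^ p) < O.valuation (g₀ - f₀ ^ p)) →
    (∀ hk : ∀ c : k, algebraMap k K c ∈ O, transcendenceDefect k O hk ≠ 0) →
    ¬ (∃ π : K, π ≠ 0 ∧ (∀ x : K, O.valuation x < 1 → O.valuation x ≤ O.valuation π) ∧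
      (∀ x : K, x ≠ 0 → ∃ n : ℕ, O.valuation π ^ n ≤ O.valuation x)) →
    ¬ PRankTwoAt p O →
    CleanLUConcl p k K O A g₀

/-- The imperfect slice ⟸ THEOREM T′'s slice ∧ the two imperfect residuals (`by_cases` on (P2) and on the separability pair). [folklore] -/
theorem cleanLU3DefectImperfectAt_of_subslices (p : ℕ) (hT : CleanLU3DefectPRankTwoSepAt p)
    (hins : CleanLU3DefectImperfectInsepAt p) (hle : CleanLU3DefectImperfectPRankLEOneAt p) :
    CleanLU3DefectImperfectAt p := by
  intro k _ _ hk K _ _ O A hAO hAfg hfrac hdimA hreg hdim3 hzd g₀ hg₀ hdef htd hnd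
  by_cases hP : PRankTwoAt p O
  · by_cases hsep : SepGenerated k K ∧ ResidueSeparable k O
    · exact hT k K O A hAO hAfg hfrac hdimA hreg hdim3 hzd g₀ hg₀ hdef htd hnd hP hsep.1 hsep.2
    · exact hins k hk K O A hAO hAfg hfrac hdimA hreg hdim3 hzd g₀ hg₀ hdef htd hnd hP hsep
  · exact hle k hk K O A hAO hAfg hfrac hdimA hreg hdim3 hzd g₀ hg₀ hdef htd hnd hP

/-- **Five-slice cut** ✓: `stub_cleanLU3DefectNonDiscrete` at `p` ⟸ THEOREM T's slice (perfect `k`, (P2)) ∧ THEOREM T′'s slice ((P2),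
separable constants) ∧ the three RESEARCH residuals: perfect `[Γ:pΓ] ≤ p` · imperfect inseparable-constants · imperfect `[Γ:pΓ] ≤ p`.
(THEOREM T′'s slice would absorb THEOREM T's given the folklore «perfect ⇒ (SEP-K) ∧ (SEP-κ)», not formalised here.) [folklore] -/
theorem cleanLU3DefectNonDiscreteAt_of_five (p : ℕ) (h2 : CleanLU3DefectPRankTwoAt p) (hT : CleanLU3DefectPRankTwoSepAt p)
    (h1 : CleanLU3DefectPRankLEOneAt p) (hins : CleanLU3DefectImperfectInsepAt p) (hle : CleanLU3DefectImperfectPRankLEOneAt p) :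
    CleanLU3DefectNonDiscreteAt p :=
  cleanLU3DefectNonDiscreteAt_of_slices p h2 h1 (cleanLU3DefectImperfectAt_of_subslices p hT hins hle)

/-- (SEP-κ) IS AUTOMATIC in the stub's setting over a perfect field ✓: if the centre of `O` on every finitely generated `T ⊇ A` inside
`O` is maximal (hypothesis `hzd` of the stub: `O` is zero-dimensional over `A`), then every residue of `O` is algebraic over `k`
(Zariski's lemma for the field `k[A, t]/centre`), hence separable when `k` is perfect.  (rev 3; discharges half of the folklore.)
[folklore] -/
theorem residueSeparable_of_isMaximal_centre (k : Type) [Field k] [PerfectField k] {K : Type} [Field K] [Algebra k K]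
    (O : ValuationSubring K) (A : Subalgebra k K) (hAO : A.toSubring ≤ O.toSubring) (hAfg : A.FG)
    (hzd : ∀ (T : Subring K) (hT : T ≤ O.toSubring), A.toSubring ≤ T → (subringCentre T O hT).IsMaximal) :
    ResidueSeparable k O := by
  classical
  intro t ht
  obtain ⟨sA, hsA⟩ := hAfg
  set B : Subalgebra k K := Algebra.adjoin k (↑(insert t sA) : Set K) with hBdef
  have hBfg : B.FG := ⟨insert t sA, rfl⟩
  have hAB : A ≤ B := by
    rw [← hsA]
    exact Algebra.adjoin_mono (by rw [Finset.coe_insert]; exact Set.subset_insert _ _)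
  have htB : t ∈ B := Algebra.subset_adjoin (by rw [Finset.coe_insert]; exact Set.mem_insert _ _)
  -- `B ⊆ O`
  let O' : Subalgebra k K :=
    { O.toSubring with
      algebraMap_mem' := fun c => hAO (A.algebraMap_mem c) }
  have hBO' : B ≤ O' := by
    apply Algebra.adjoin_le
    intro x hx
    rw [Finset.coe_insert] at hx
    rcases hx with rfl | hx
    · exact ht
    · exact hAO (hsA ▸ Algebra.subset_adjoin hx)
  have hBO : B.toSubring ≤ O.toSubring := fun x hx => hBO' hx
  have hABs : A.toSubring ≤ B.toSubring := fun x hx => hAB hx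
  have hmax := hzd B.toSubring hBO hABs
  -- the centre as an ideal of the `k`-algebra `B`
  let 𝔭 : Ideal B := subringCentre B.toSubring O hBO
  haveI h𝔭max : 𝔭.IsMaximal := hmax
  letI : Field (B ⧸ 𝔭) := Ideal.Quotient.field 𝔭
  haveI : Algebra.FiniteType k B := (Subalgebra.fg_iff_finiteType B).mp hBfg
  haveI : Algebra.FiniteType k (B ⧸ 𝔭) :=
    Algebra.FiniteType.of_surjective (Ideal.Quotient.mkₐ k 𝔭) (Ideal.Quotient.mkₐ_surjective k 𝔭)
  haveI : Module.Finite k (B ⧸ 𝔭) := finite_of_finite_type_of_isJacobsonRing k (B ⧸ 𝔭)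
  have hint : IsIntegral k (Ideal.Quotient.mk 𝔭 ⟨t, htB⟩) := Algebra.IsIntegral.isIntegral _
  refine ⟨minpoly k (Ideal.Quotient.mk 𝔭 ⟨t, htB⟩), ?_, ?_⟩
  · exact PerfectField.separable_of_irreducible (minpoly.irreducible hint)
  · have h1 : Polynomial.aeval (Ideal.Quotient.mk 𝔭 ⟨t, htB⟩) (minpoly k (Ideal.Quotient.mk 𝔭 ⟨t, htB⟩)) = 0 :=
      minpoly.aeval k _
    have h2 : Ideal.Quotient.mkₐ k 𝔭 (Polynomial.aeval (⟨t, htB⟩ : B) (minpoly k (Ideal.Quotient.mk 𝔭 ⟨t, htB⟩))) = 0 := by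
      rw [← Polynomial.aeval_algHom_apply, Ideal.Quotient.mkₐ_eq_mk]
      exact h1
    rw [Ideal.Quotient.mkₐ_eq_mk] at h2
    have h3 : Polynomial.aeval (⟨t, htB⟩ : B) (minpoly k (Ideal.Quotient.mk 𝔭 ⟨t, htB⟩)) ∈ 𝔭 :=
      Ideal.Quotient.eq_zero_iff_mem.mp h2
    have h4 := (mem_subringCentre_iff hBO _).mp h3
    have h5 : ((Polynomial.aeval (⟨t, htB⟩ : B) (minpoly k (Ideal.Quotient.mk 𝔭 ⟨t, htB⟩)) : B) : K) =
        Polynomial.aeval t (minpoly k (Ideal.Quotient.mk 𝔭 ⟨t, htB⟩)) := by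
      change B.val (Polynomial.aeval _ _) = _
      rw [← Polynomial.aeval_algHom_apply]
      rfl
    rw [← h5]
    exact h4

/-- Over a perfect field every finitely generated field extension has a (finite) separating transcendence basis (MacLane 1939) —
rev 6: PROVED from Mathlib's `exists_isTranscendenceBasis_and_isSeparable_of_perfectField` (was a named statement in rev 2–5). [folklore] -/
def SepGeneratedOfPerfect : Prop :=
    ∀ (k : Type) [Field k] [PerfectField k] (K : Type) [Field K] [Algebra k K] (A : Subalgebra k K),
      A.FG → IsFractionRing A K → SepGenerated k K

theorem sepGeneratedOfPerfect : SepGeneratedOfPerfect := by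
  intro k _ _ K _ _ A hAfg hfrac
  haveI : Algebra.FiniteType k A := A.fg_iff_finiteType.mp hAfg
  haveI : Algebra.EssFiniteType A K := Algebra.EssFiniteType.of_isLocalization K (nonZeroDivisors A)
  haveI : Algebra.EssFiniteType k K := Algebra.EssFiniteType.comp k A K
  obtain ⟨s, hs, hsep⟩ := exists_isTranscendenceBasis_and_isSeparable_of_perfectField k K
  refine ⟨s.card, fun i => ((s.equivFin.symm i : s) : K), hs.1.comp _ s.equivFin.symm.injective, ?_⟩
  have hr : Set.range (fun i => ((s.equivFin.symm i : s) : K)) = (s : Set K) := by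
    ext x
    constructor
    · rintro ⟨i, rfl⟩
      exact (s.equivFin.symm i).2
    · intro hx
      exact ⟨s.equivFin ⟨x, hx⟩, by simp⟩
  rw [hr]
  exact hsep

/-- THEOREM T′'s slice ⟹ THEOREM T's slice (rev 6: hypothesis-free): over a perfect field `K/k` is separably generated
(`sepGeneratedOfPerfect` ✓, Mathlib) and the residue field is separable (`residueSeparable_of_isMaximal_centre` ✓). [folklore] -/
theorem cleanLU3DefectPRankTwoAt_of_sep (p : ℕ)
    (hT : CleanLU3DefectPRankTwoSepAt p) : CleanLU3DefectPRankTwoAt p := by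
  intro k _ _ _ K _ _ O A hAO hAfg hfrac hdimA hreg hdim3 hzd g₀ hg₀ hdef htd hnd hP
  have hs : SepGenerated k K := sepGeneratedOfPerfect k K A hAfg hfrac
  have hr : ResidueSeparable k O := residueSeparable_of_isMaximal_centre k O A hAO hAfg hzd
  exact hT k K O A hAO hAfg hfrac hdimA hreg hdim3 hzd g₀ hg₀ hdef htd hnd hP hs hr

/-! ## §6 (rev 4) Sizing the perfect-field residual `[Γ:pΓ] ≤ p`: the two sub-slices `s = 1` and `s = 0` -/

/-- `s = 1`: `[Γ : pΓ] = p` exactly — (P2) fails but SOME value is not a `p`-th-power value (e.g. `Γ = ℤ[1/ℓ]`, `ℓ ≠ p`, or a rank-one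
`Γ` of rational rank 2 with one `p`-divisible direction).  THEOREM T's machine still produces a regular model of `K₁ := K^p(g₀)(x₀)` along
`v` with TWO regular parameters in `M = K^p(g₀)`; what is missing is the lift through the IMMEDIATE degree-`p` layer `K/K₁` (memo §11).
[folklore] -/
def PRankOneAt {K : Type} [Field K] (p : ℕ) (O : ValuationSubring K) : Prop :=
    ¬ PRankTwoAt p O ∧ ∃ x : K, x ≠ 0 ∧ ∀ z : K, z ≠ 0 → O.valuation x ≠ O.valuation (z ^ p)

/-- `s = 0`: every value is a `p`-th-power value (`Γ = pΓ`, e.g. `Γ = ℤ[1/p]`): `K/K^p(g₀)` is immediate of degree `p²` and even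
`K^{1/p}/K` is immediate — the «everything immediate» core (transcendence defect 2). [folklore] -/
def PDivisibleValuesAt {K : Type} [Field K] (p : ℕ) (O : ValuationSubring K) : Prop :=
    ∀ x : K, x ≠ 0 → ∃ z : K, z ≠ 0 ∧ O.valuation x = O.valuation (z ^ p)

/-- `[Γ:pΓ] ≤ p` splits as `s = 1` or `s = 0` (pure logic). [folklore] -/
theorem pRankOne_or_pDivisible_of_not_pRankTwo {K : Type} [Field K] (p : ℕ) (O : ValuationSubring K)
    (h : ¬ PRankTwoAt p O) : PRankOneAt p O ∨ PDivisibleValuesAt p O := by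
  by_cases hx : ∃ x : K, x ≠ 0 ∧ ∀ z : K, z ≠ 0 → O.valuation x ≠ O.valuation (z ^ p)
  · exact Or.inl ⟨h, hx⟩
  · right
    intro x hx0
    by_contra hcon
    apply hx
    refine ⟨x, hx0, fun z hz heq => hcon ⟨z, hz, heq⟩⟩

/-- Residual 1, sub-slice `s = 1` (perfect `k`, `PRankOneAt`).  RESEARCH; nothing claimed (memo §11 sizes it: one immediate layer on top of a
THEOREM-T base). [folklore] -/
def CleanLU3DefectPRankOneAt (p : ℕ) : Prop :=
    ∀ (k : Type) [Field k] [CharP k p] [PerfectField k] (K : Type) [Field K] [Algebra k K]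
    (O : ValuationSubring K) (A : Subalgebra k K), A.toSubring ≤ O.toSubring → A.FG → IsFractionRing A K →
    ringKrullDim A ≤ 3 → IsRegularLocalRing (locAtCentre A.toSubring O) →
    ringKrullDim (locAtCentre A.toSubring O) = 3 →
    (∀ (T : Subring K) (hT : T ≤ O.toSubring), A.toSubring ≤ T → (subringCentre T O hT).IsMaximal) →
    ∀ g₀ : K, (∀ c : K, c ^ p ≠ g₀) →
    (∀ f₀ : K, ∃ f₁ : K, O.valuation (g₀ - f₁ ^ p) < O.valuation (g₀ - f₀ ^ p)) →
    (∀ hk : ∀ c : k, algebraMap k K c ∈ O, transcendenceDefect k O hk ≠ 0) →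
    ¬ (∃ π : K, π ≠ 0 ∧ (∀ x : K, O.valuation x < 1 → O.valuation x ≤ O.valuation π) ∧
      (∀ x : K, x ≠ 0 → ∃ n : ℕ, O.valuation π ^ n ≤ O.valuation x)) →
    PRankOneAt p O →
    CleanLUConcl p k K O A g₀

/-- Residual 1, sub-slice `s = 0` (perfect `k`, `PDivisibleValuesAt`).  RESEARCH; nothing claimed (memo §11: no reduction known; Kuhlmann's
henselian rationality needs a tame base or a finite base extension). [folklore] -/
def CleanLU3DefectPDivAt (p : ℕ) : Prop :=
    ∀ (k : Type) [Field k] [CharP k p] [PerfectField k] (K : Type) [Field K] [Algebra k K]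
    (O : ValuationSubring K) (A : Subalgebra k K), A.toSubring ≤ O.toSubring → A.FG → IsFractionRing A K →
    ringKrullDim A ≤ 3 → IsRegularLocalRing (locAtCentre A.toSubring O) →
    ringKrullDim (locAtCentre A.toSubring O) = 3 →
    (∀ (T : Subring K) (hT : T ≤ O.toSubring), A.toSubring ≤ T → (subringCentre T O hT).IsMaximal) →
    ∀ g₀ : K, (∀ c : K, c ^ p ≠ g₀) →
    (∀ f₀ : K, ∃ f₁ : K, O.valuation (g₀ - f₁ ^ p) < O.valuation (g₀ - f₀ ^ p)) →
    (∀ hk : ∀ c : k, algebraMap k K c ∈ O, transcendenceDefect k O hk ≠ 0) →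
    ¬ (∃ π : K, π ≠ 0 ∧ (∀ x : K, O.valuation x < 1 → O.valuation x ≤ O.valuation π) ∧
      (∀ x : K, x ≠ 0 → ∃ n : ℕ, O.valuation π ^ n ≤ O.valuation x)) →
    PDivisibleValuesAt p O →
    CleanLUConcl p k K O A g₀

/-- Residual 1 ⟸ its two sub-slices ✓. [folklore] -/
theorem cleanLU3DefectPRankLEOneAt_of_split (p : ℕ) (h1 : CleanLU3DefectPRankOneAt p) (h0 : CleanLU3DefectPDivAt p) :
    CleanLU3DefectPRankLEOneAt p := by
  intro k _ _ _ K _ _ O A hAO hAfg hfrac hdimA hreg hdim3 hzd g₀ hg₀ hdef htd hnd hP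
  rcases pRankOne_or_pDivisible_of_not_pRankTwo p O hP with hs1 | hs0
  · exact h1 k K O A hAO hAfg hfrac hdimA hreg hdim3 hzd g₀ hg₀ hdef htd hnd hs1
  · exact h0 k K O A hAO hAfg hfrac hdimA hreg hdim3 hzd g₀ hg₀ hdef htd hnd hs0

/-! ## §7 (rev 5/6) The field-theoretic input of (PB): the p-degree (`PDegreeThreeOfPerfect` PROVED from the tree in rev 6; the relative form a statement)

THEOREM T's step (PB) needs, besides the valuation half now kernel-checked in `Lens5_GradedBasis.lean` (independence) and
`Lens5_ImmediateValues.lean` ((V) inside `K`, `[K^p(g₀):K^p] = p`, and `[K : K^p(g₀)] = p²` FROM `[K : K^p] = p³`), exactly one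
field-theoretic input absent from Mathlib: the p-DEGREE of the function field.  Over a perfect ground field it is `PDegreeThreeOfPerfect`;
in general (THEOREM T′) it is `PDegreeThreeOfSepGenerated` (p-basis = separating transcendence basis, MacLane), and
`PDegreeThreeOfPerfect` follows from `PDegreeThreeOfSepGenerated` + `SepGeneratedOfPerfect` (§5) since `k ⊆ K^p` for perfect `k`.
Both are textbook (Matsumura, Commutative Ring Theory §26, Thm 26.5–26.8; Bourbaki A.V §13) and typed over the stub's own data. -/

/-- For a PERFECT field `k` of characteristic `p` and a field `K = Frac A`, `A` a finitely generated `k`-algebra of Krull dimension `3`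
(so `trdeg_k K = 3`): `[K : K^p] = p³`, `K^p = (frobenius K p).fieldRange`.  rev 6: PROVED below from the tree (Matsumura Thm 26.5 + 5.6). -/
def PDegreeThreeOfPerfect (p : ℕ) [Fact p.Prime] : Prop :=
    ∀ (k : Type) [Field k] [PerfectField k] [CharP k p] (K : Type) [Field K] [Algebra k K] [CharP K p] (A : Subalgebra k K),
      A.FG → IsFractionRing A K → ringKrullDim A = 3 → Module.finrank (frobenius K p).fieldRange K = p ^ 3

/-- `PDegreeThreeOfPerfect` from the tree: `[K : K^p] = p^{trdeg_k K}` (`finrank_frobenius_eq_pow_of_trdeg_eq`, Matsumura Thm 26.5) and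
`trdeg_k K = trdeg_k A = dim A = 3` (`exists_ringKrullDim_eq_and_trdeg_eq`, Thm 5.6; `trdeg_add_eq` + `trdeg_eq_zero` for `K = Frac A`).
[cite: Matsumura1987, Thm. 26.5 and Thm. 5.6] -/
theorem pDegreeThreeOfPerfect (p : ℕ) [Fact p.Prime] : PDegreeThreeOfPerfect p := by
  intro k _ _ _ K _ _ _ A hAfg hfrac hdim
  haveI : Algebra.FiniteType k A := A.fg_iff_finiteType.mp hAfg
  haveI : Algebra.EssFiniteType A K := Algebra.EssFiniteType.of_isLocalization K (nonZeroDivisors A)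
  haveI : Algebra.EssFiniteType k K := Algebra.EssFiniteType.comp k A K
  obtain ⟨s, hs, htr⟩ := Literature.RingTheory.KrullDimension.exists_ringKrullDim_eq_and_trdeg_eq k A
  have hs3 : s = 3 := by
    rw [hs] at hdim
    exact_mod_cast hdim
  haveI : FaithfulSMul k A := (faithfulSMul_iff_algebraMap_injective k A).mpr (algebraMap k A).injective
  haveI : FaithfulSMul A K := (faithfulSMul_iff_algebraMap_injective A K).mpr (IsFractionRing.injective A K)
  haveI : Algebra.IsAlgebraic A K := IsLocalization.isAlgebraic K (nonZeroDivisors A)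
  have htrK : Algebra.trdeg k K = (3 : ℕ) := by
    rw [← trdeg_add_eq k A (A := K), trdeg_eq_zero (R := A) (A := K), add_zero, htr, hs3]
  exact Literature.FieldTheory.Separability.finrank_frobenius_eq_pow_of_trdeg_eq p htrK

/-- NAMED FACT here — PROVED (binders verbatim, `SepGenerated` unfolded) as `Lens5_PDegreeSep.pDegreeThreeOfSepGenerated` (crux workfile
`Lens5_PDegreeSep.lean`, 2026-08-29; Matsumura 26.5 relative to `k·K^p`: dual derivations kill `k·K^p`; not importable here). p-basis = separating transcendence basis.  For a field `k` of characteristic `p` and a SEPARABLY GENERATED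
`K = Frac A` over `k`, `A` a finitely generated `k`-algebra of Krull dimension `3`: `[K : k·K^p] = p³`, where `k·K^p` is the subfield
generated by (the image of) `k` and `K^p`. -/
def PDegreeThreeOfSepGenerated (p : ℕ) [Fact p.Prime] : Prop :=
    ∀ (k : Type) [Field k] [CharP k p] (K : Type) [Field K] [Algebra k K] [CharP K p] (A : Subalgebra k K),
      A.FG → IsFractionRing A K → ringKrullDim A = 3 → SepGenerated k K →
        Module.finrank (Subfield.closure (Set.range (algebraMap k K) ∪ Set.range (frobenius K p))) K = p ^ 3

/-! ## §8 (rev 7) EXIT LEMMA — a regular parameter `ψ ∈ K^p(g₀)` of a regular model gives `CleanLUConcl` FORM (3) with `c′ = 0`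

This is the last line of THEOREM T (memo §5): the toric chart `S_τ = locAtCentre A''.toSubring O` is regular and one of its regular
parameters `ψ` lies in `M = K^p(g₀)`, i.e. `ψ = Σ_{j<p} c_j^p g₀^j` (`Lens5_ImmediateValues.mem_adjoin_pthPowers_iff`); then
`(c_j)` is a non-trivial representative (some `c_j ≠ 0`, `j ≠ 0`, because `ψ` is not a `p`-th power in `K`: regular ⇒ normal,
`Literature…isIntegrallyClosedIn_of_isRegularLocalRing`) and FORM (3) holds with `s := ψ`, `c′ := 0`. -/

/-- (copied from `Lens5_PunchlineBits`) an element of `𝔪 ∖ 𝔪²` of a local domain integrally closed in `K` is no `p`-th power in `K`. -/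
theorem pow_ne_of_mem_maximalIdeal_of_not_mem_sq' {K : Type} [Field K] (S : Subring K) [IsLocalRing S]
    (hic : ∀ w : K, IsIntegral S w → w ∈ S) {p : ℕ} (hp : 2 ≤ p) (ψ : S)
    (h1 : ψ ∈ IsLocalRing.maximalIdeal S) (h2 : ψ ∉ (IsLocalRing.maximalIdeal S) ^ 2) :
    ∀ w : K, w ^ p ≠ (ψ : K) := by
  intro w hw
  have hp0 : 0 < p := by omega
  have hint : IsIntegral S w := by
    apply IsIntegral.of_pow hp0
    rw [hw]
    exact isIntegral_algebraMap (R := S) (x := ψ)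
  have hwS : w ∈ S := hic w hint
  set y : S := ⟨w, hwS⟩ with hy
  have hyp : y ^ p = ψ := by
    apply Subtype.ext
    simp [hy, hw]
  have hym : y ∈ IsLocalRing.maximalIdeal S := by
    by_contra hcontra
    have hyu : IsUnit y := by
      simpa [IsLocalRing.mem_maximalIdeal, mem_nonunits_iff] using hcontra
    have hψu : IsUnit ψ := by rw [← hyp]; exact hyu.pow p
    exact (IsLocalRing.mem_maximalIdeal _ |>.mp h1) hψu
  apply h2
  rw [← hyp]
  exact Ideal.pow_le_pow_right hp (Ideal.pow_mem_pow hym p)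

/-- **EXIT LEMMA of THEOREM T.**  A finitely generated `A'' ⊇ A` inside `O` with `locAtCentre A''.toSubring O` regular, and a regular
parameter `ψ ∈ 𝔪 ∖ 𝔪²` of it written `ψ = Σ_{j<p} c_j^p g₀^j`, give `CleanLUConcl p k K O A g₀` in FORM (3) (`s := ψ`, `c′ := 0`); the
representative is automatically non-trivial. -/
theorem cleanLUConcl_of_parameter {p : ℕ} [Fact p.Prime] {k K : Type} [Field k] [Field K] [Algebra k K]
    (O : ValuationSubring K) (A A'' : Subalgebra k K) [IsFractionRing A K]
    (hA''O : A''.toSubring ≤ O.toSubring) (hAA'' : A ≤ A'') (hA''fg : A''.FG)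
    (hreg : IsRegularLocalRing (locAtCentre A''.toSubring O)) (g₀ : K)
    (ψ : locAtCentre A''.toSubring O) (hψ1 : ψ ∈ IsLocalRing.maximalIdeal (locAtCentre A''.toSubring O))
    (hψ2 : ψ ∉ (IsLocalRing.maximalIdeal (locAtCentre A''.toSubring O)) ^ 2)
    (c : Fin p → K) (hc : ∑ j : Fin p, c j ^ p * g₀ ^ (j : ℕ) = (ψ : K)) :
    CleanLUConcl p k K O A g₀ := by
  have hpp : p.Prime := Fact.out
  haveI : NeZero p := ⟨hpp.ne_zero⟩
  haveI := hreg
  -- `Frac (locAtCentre A'' O) = K` (it contains `A`)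
  haveI : IsFractionRing (locAtCentre A''.toSubring O) K := by
    refine IsFractionRing.of_field _ _ (fun z => ?_)
    obtain ⟨a, b, hb, rfl⟩ := IsFractionRing.div_surjective (A := A) z
    have haR : (a : K) ∈ locAtCentre A''.toSubring O := le_locAtCentre _ O (hAA'' a.2)
    have hbR : (b : K) ∈ locAtCentre A''.toSubring O := le_locAtCentre _ O (hAA'' b.2)
    exact ⟨⟨a, haR⟩, ⟨b, hbR⟩, rfl⟩
  have hicIn := isIntegrallyClosedIn_of_isRegularLocalRing (locAtCentre A''.toSubring O)
  have hic : ∀ w : K, IsIntegral (locAtCentre A''.toSubring O) w → w ∈ locAtCentre A''.toSubring O := by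
    intro w hw
    obtain ⟨y, hy⟩ := (IsIntegrallyClosedIn.isIntegral_iff (R := locAtCentre A''.toSubring O) (A := K)).mp hw
    rw [← hy]
    exact y.2
  -- non-triviality of the representative
  have hnt : ∃ j : Fin p, (j : ℕ) ≠ 0 ∧ c j ≠ 0 := by
    by_contra hall
    push Not at hall
    have hsum : ∑ j : Fin p, c j ^ p * g₀ ^ (j : ℕ) = c 0 ^ p := by
      rw [Finset.sum_eq_single (0 : Fin p)]
      · simp
      · intro j _ hj
        have hj' : (j : ℕ) ≠ 0 := fun h => hj (Fin.ext (by simpa using h))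
        rw [hall j hj', zero_pow hpp.ne_zero, zero_mul]
      · intro h; exact absurd (Finset.mem_univ _) h
    exact pow_ne_of_mem_maximalIdeal_of_not_mem_sq' (locAtCentre A''.toSubring O) hic hpp.two_le ψ hψ1 hψ2 (c 0)
      (by rw [← hsum, hc])
  refine ⟨A'', hA''O, hAA'', hA''fg, hreg, c, hnt, Or.inr (Or.inr ⟨ψ, 0, hc, ?_, ?_⟩)⟩
  · simpa [zero_pow hpp.ne_zero] using hψ1
  · simpa [zero_pow hpp.ne_zero] using hψ2

end Summit.ResolutionOfSingularities.ResolutionOfSingularities.Cruxes.DescentPerfectToAll.CpSibling.PRankTwo
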